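import Summits.Ventures.CertifiedManyBodySolver.Downfold.EmeryShapeWindowClosureBand
import Summits.Ventures.CertifiedManyBodySolver.Downfold.EmeryFermiScalePointsBi2223OPK14VirtualCorners
import HarnessLib

/-!
# THE ONE-BAND FERMI-SURFACE SHAPE `t′/t` OF THE WHOLE TYPED 3BE BOX `emeryBoxBi2223OPK14Src (EmeryBoxesKSlicesP)` OVER ITS WHOLE FILLING BAND (two-ray rule + band window closure, §B.86 (k);
# router/EMERY-SHAPE-CORNERS.tsv «band» row)

Venture CertifiedManyBodySolver, cell `pub/hubbard-downfold` (stage S1; INFLATION-RULES-3to1-B §B.86 (k)), seat hubbard-downfold-mod-4 (technique B, g35); namespace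
`Summit.Ventures.CertifiedManyBodySolver.Downfold.Emery`. Everything PROVED (0 sorry). WHAT THIS IS NOT: a statement about Bi₂Sr₂Ca₂Cu₃O₁₀ OUTER plane ((K) source box) — the typed box is SCREENING-GRADE;
`U = 0` one-body kinematics of the σ model (rigid band); object E = the EXACT `t–t′` shape of the σ Fermi surface.

**For EVERY one-body row of the box AND EVERY filling of the band n_H ∈ [1.1560000000000001, 1.197] (ν ∈ [803/2000, 211/500]): n_H = 1.156 (ν = 211/500) … n_H = 1.197 (ν = 803/2000), the one-band t′/t of the σ Fermi surface at that row's own Fermi energy lies in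
[-0.3179, -0.2411]** (`bi2223OPK14Box_fsRatio_band`) — `fsRatio_fermiEnergyOf_mem_Icc_windowClosure_band` with the end-filling point brackets: lower window
[ε_F(V_lo; ν₁)⁻, ε_F(A_lo; ν₂)⁺] = [1.4254, 1.5247] (closure antitone), upper window [0, ε_F(V_hi; ν₂)⁺] = [0, 1.6971] (monotone), regime at ε_F(H; ν₂)⁺ = 1.8983. The per-filling windows of
`EmeryBoxesBi2223OPK14ShapeCorners` are nested inside (same certificates).

Sources: three-band model [HybertsenSchluterChristensen1989, Eq. (1)]; [AndersenEtAl1995, §6]; box rows as cited in the typed object's file.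
-/

noncomputable section

namespace Summit.Ventures.CertifiedManyBodySolver.Downfold.Emery

open Real Set

/-- **Bi₂Sr₂Ca₂Cu₃O₁₀ OUTER plane ((K) source box), filling band n_H ∈ [1.1560000000000001, 1.197] (ν ∈ [803/2000, 211/500]): n_H = 1.156 (ν = 211/500) … n_H = 1.197 (ν = 803/2000): for every row of the box and every filling of the band, the one-band Fermi-surface `t′/t` (object E) lies in `[-0.3179, -0.2411]`.** [folklore] -/
theorem bi2223OPK14Box_fsRatio_band {Δ a b c ν : ℝ} (hΔ : Δ ∈ Icc ((39 : ℝ) / 20) ((51 : ℝ) / 20)) (ha : a ∈ Icc ((59 : ℝ) / 50) ((139 : ℝ) / 100)) (hb : b ∈ Icc ((61 : ℝ) / 100) ((18 : ℝ) / 25)) (hc : c ∈ Icc ((7 : ℝ) / 50) ((17 : ℝ) / 100)) (hν : ν ∈ Icc ((803 : ℝ) / 2000) ((211 : ℝ) / 500)) :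
    fsRatio Δ a b c (fermiEnergyOf Δ a b c ν) ∈ Icc ((-3179 : ℝ) / 10000) ((-2411 : ℝ) / 10000) := by
  have hV : ((17 : ℝ) / 100) * ((18 : ℝ) / 25) / ((61 : ℝ) / 100) = ((306 : ℝ) / 1525) := by norm_num
  have hW : ((7 : ℝ) / 50) * ((61 : ℝ) / 100) / ((18 : ℝ) / 25) = ((427 : ℝ) / 3600) := by norm_num
  have hVlo := (fermiEnergyOf_of_pointBracketCheck virtPt_Bi2223OPK14Vlo_nH1197_br (by norm_num) (by norm_num) (by norm_num) (ν := (803/2000 : ℝ)) (by push_cast; exact ⟨le_rfl, le_rfl⟩)).2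
  have hVhi := (fermiEnergyOf_of_pointBracketCheck virtPt_Bi2223OPK14Vhi_nH1156_br (by norm_num) (by norm_num) (by norm_num) (ν := (211/500 : ℝ)) (by push_cast; exact ⟨le_rfl, le_rfl⟩)).2
  have hAlo := (fermiEnergyOf_of_pointBracketCheck virtPt_Bi2223OPK14Alo_nH1156_br (by norm_num) (by norm_num) (by norm_num) (ν := (211/500 : ℝ)) (by push_cast; exact ⟨le_rfl, le_rfl⟩)).2
  have hTop := (fermiEnergyOf_of_pointBracketCheck virtPt_Bi2223OPK14H_nH1156_br (by norm_num) (by norm_num) (by norm_num) (ν := (211/500 : ℝ)) (by push_cast; exact ⟨le_rfl, le_rfl⟩)).2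
  have hLo2 := (fermiEnergyOf_of_pointBracketCheck virtPt_Bi2223OPK14Vlo_nH1197_br (by norm_num) (by norm_num) (by norm_num) (ν := (803/2000 : ℝ)) (by push_cast; exact ⟨le_rfl, le_rfl⟩)).2
  push_cast at hVlo hVhi hAlo hTop
  norm_num at hVlo hVhi hAlo hTop
  refine fsRatio_fermiEnergyOf_mem_Icc_windowClosure_band (Δ₁ := ((39 : ℝ) / 20)) (Δ₂ := ((51 : ℝ) / 20)) (a₁ := ((59 : ℝ) / 50)) (a₂ := ((139 : ℝ) / 100)) (b₁ := ((61 : ℝ) / 100))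
    (b₂ := ((18 : ℝ) / 25)) (c₁ := ((7 : ℝ) / 50)) (c₂ := ((17 : ℝ) / 100)) (e₁ := ((7127 : ℝ) / 5000)) (e₂ := ((15247 : ℝ) / 10000)) (e₃ := 0) (e₄ := ((16971 : ℝ) / 10000)) (ν₁ := ((803 : ℝ) / 2000)) (ν₂ := ((211 : ℝ) / 500)) (by norm_num) (by norm_num) (by norm_num) (by norm_num)
    (by norm_num) hΔ ha hb hc (by norm_num) hν (by norm_num) ?_ ?_ ?_ (by norm_num) ?_ ?_ ?_ (by norm_num) ?_
  · nlinarith [hTop.2]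
  · rw [hV]; exact hVlo.1
  · exact hAlo.2
  · intro ε hε
    rw [hV]
    have hanti := (fsRatio_mem_Icc_on_window_of_dopingDisc_nonneg (Δ := ((39 : ℝ) / 20)) (a := ((59 : ℝ) / 50)) (b := ((18 : ℝ) / 25)) (c := ((306 : ℝ) / 1525))
      (p := ((7127 : ℝ) / 5000)) (q := ((15247 : ℝ) / 10000)) (by norm_num) (by norm_num) (by norm_num) (by norm_num) (by norm_num) (by norm_num) (by norm_num)
      (by norm_num [dopingDisc]) hε).1
    refine le_trans ?_ hanti
    norm_num [fsRatio, fsD, fsN]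
  · exact (fermiEnergyOf_pos (by norm_num) (by norm_num) (by norm_num) (by norm_num) (by norm_num) (by norm_num)).le
  · rw [hW]; exact hVhi.2
  · intro ε hε
    rw [hW]
    have hmono := (fsRatio_mem_Icc_on_window_of_dopingDisc_nonpos (Δ := ((51 : ℝ) / 20)) (a := ((139 : ℝ) / 100)) (b := ((61 : ℝ) / 100)) (c := ((427 : ℝ) / 3600))
      (p := 0) (q := ((16971 : ℝ) / 10000)) (by norm_num) (by norm_num) (by norm_num) (by norm_num) (by norm_num) (by norm_num) (by norm_num)
      (by norm_num [dopingDisc]) hε).2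
    refine le_trans hmono ?_
    norm_num [fsRatio, fsD, fsN]

end Summit.Ventures.CertifiedManyBodySolver.Downfold.Emery
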